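import Summits.AnomalousDissipation.AnomalousDissipation.Theorems.BaireTransferRobustLoudUpgradeLineCrossingGlue
import Summits.AnomalousDissipation.AnomalousDissipation.Theorems.BaireTransferRobustLoudUpgradeStubLsIndefinite

/-!
# Line `malkin-cone-group-orbits`, companion c2 ("Lyapunov–Schmidt crossing"): the INVISIBLE SADDLE class and the extended line glue

Definitions + glue (reviewed for the two definitions).  `indefiniteSteady` packages the hypotheses of the landed
`LsIndefiniteNS.stub_lsIndefinite` (a first-order invisible force direction with an indefinite second-order form, read off classical
solvability); `indefiniteSteady ⊆ robustCrossingSteady ⊆ closure (interior LOUD)` by identifying its family with the one of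
`LsFamily.stub_lsFamily` through the uniqueness clause (pattern of `foldSteady_subset_robustCrossingSteady`); `tameCrossing2 := tameCrossing ∪
indefiniteSteady`; `line_glue_c2b` (registered): the residual over `tameCrossing2` proves the crux BY NAME.  After this file the simple-kernel steady
case of the crux's residual is: crossing ∪ subharmonic ∪ fold ∪ indefinite ∪ GHOST (definite second-order form) (+ non-isolated vertical families).
-/

-- `Summit.<Summit>.<Problem>` is the tree's mandated summit-side namespace (CONVENTIONS §2); for this
-- single-conjunct summit the two coincide, so the duplicate is deliberate.
set_option linter.dupNamespace false

noncomputable section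

open scoped BigOperators Topology
open Filter Set Function TopologicalSpace MeasureTheory UnitAddTorus

namespace Summit.AnomalousDissipation.AnomalousDissipation.Theorems.RobustLoudUpgrade

open Literature.Analysis.FunctionSpaces Literature.Analysis.FunctionSpaces.Torus
open Literature.Analysis.FunctionSpaces.EuclideanSpace
open Literature.Analysis.FluidPDE
open Summit.AnomalousDissipation.AnomalousDissipation.Theses.BaireTransfer

/-- **Invisible saddles** (third concrete member, of `robustCrossingSteady`).  `c` carries, at some `ν ∈ (0,a)`, a mean-zero classical
steady state `u₀` with strict budgets whose classical mean-zero kernel lies on the complex line of one smooth divergence-free mean-zero real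
field `v`, an admissible border field `h ∉ range L(ν,u₀)`, and a force direction `d ∈ P_S` which is first-order INVISIBLE — witnessed by a real
admissible linear response `w_d`, `L(ν,u₀) w_d = −f_d`, of phase `∫⟪v, w_d⟫ = 0` — along which the second-order form is INDEFINITE, witnessed by
classical solvability: `L(ν,u₀) w = −((Z₊·∇)Z₊ + α h)` is solvable (real admissible `w`) for `Z₊ = w_d + t₊ v` with `α > 0`, and
`L(ν,u₀) w = −((Z₋·∇)Z₋ + β h)` for `Z₋ = w_d + t₋ v` with `β < 0`.  No isolation, no symmetry, no visibility inside `P_S`.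
(Kielhöfer 2012 §I.16; Golubitsky–Schaeffer 1985 Ch. II.) [folklore] -/
def indefiniteSteady (S : Finset (Fin 3 → ℤ)) (a E ε : ℝ) : Set (Coeff S) :=
  {c | ∃ ν : ℝ, 0 < ν ∧ ν < a ∧ ∃ (u₀ : UnitAddTorus (Fin 3) → EuclideanSpace ℝ (Fin 3)) (p₀ : UnitAddTorus (Fin 3) → ℝ),
    Torus.IsSteadyNSState ν (force S c) u₀ p₀ ∧ HasZeroMean u₀ ∧ meanEnergy (fun _ : ℝ => u₀) < E ∧
      ε < meanDissipation ν (fun _ : ℝ => u₀) ∧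
      ∃ (v h wd wp wm : UnitAddTorus (Fin 3) → EuclideanSpace ℝ (Fin 3)) (d : Coeff S) (tp tm α β : ℝ),
        IsSmooth v ∧ IsDivFree v ∧ HasZeroMean v ∧
        (∀ w, Torus.LinNSResolventRel ν u₀ 0 w 0 → ∃ z : ℂ, w = z • cplx v) ∧
        IsSmooth h ∧ IsDivFree h ∧ HasZeroMean h ∧ (∀ w, ¬ Torus.LinNSResolventRel ν u₀ 0 w (cplx h)) ∧
        IsSmooth wd ∧ IsDivFree wd ∧ HasZeroMean wd ∧
        Torus.LinNSResolventRel ν u₀ 0 (cplx wd) (cplx (fun y => -force S d y)) ∧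
        (∫ y, inner ℝ (v y) (wd y)) = 0 ∧ 0 < α ∧ β < 0 ∧
        IsSmooth wp ∧ IsDivFree wp ∧ HasZeroMean wp ∧
        Torus.LinNSResolventRel ν u₀ 0 (cplx wp)
          (cplx (fun y => -(Torus.convect (fun z => wd z + tp • v z) (fun z => wd z + tp • v z) y + α • h y))) ∧
        IsSmooth wm ∧ IsDivFree wm ∧ HasZeroMean wm ∧
        Torus.LinNSResolventRel ν u₀ 0 (cplx wm)
          (cplx (fun y => -(Torus.convect (fun z => wd z + tm • v z) (fun z => wd z + tm • v z) y + β • h y)))}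

/-- The tame union of the companion, extended by the invisible saddles. [folklore] -/
def tameCrossing2 (S : Finset (Fin 3 → ℤ)) (a E ε : ℝ) : Set (Coeff S) :=
  tameCrossing S a E ε ∪ indefiniteSteady S a E ε

namespace LsCrossing

/-- **`indefiniteSteady ⊆ robustCrossingSteady`** (from the landed `LsFamily.stub_lsFamily` and `LsIndefiniteNS.stub_lsIndefinite`):
the invisible-saddle family `σ₂` changes sign in `x` at forces `c + s d → c`; by the UNIQUENESS clause of `stub_lsFamily` it
coincides near `(c, 0)` with the family `σ₁` whose zeros are steady states of the uncorrected forces; so `σ₁` is a robust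
crossing (verbatim the pattern of `foldSteady_subset_robustCrossingSteady`). [folklore] -/
theorem indefiniteSteady_subset_robustCrossingSteady (S : Finset (Fin 3 → ℤ)) (a E ε : ℝ) :
    indefiniteSteady S a E ε ⊆ robustCrossingSteady S a E ε := by
  intro c hc
  obtain ⟨ν, hν, hνa, u₀, p₀, hst, h0, hE, hε, v, h, wd, wp, wm, d, tp, tm, α, β, hv₁, hv₂, hv₃, hker, hh₁, hh₂, hh₃, hvis,
    hwd₁, hwd₂, hwd₃, hresp, hphase, hα, hβ, hwp₁, hwp₂, hwp₃, hsolp, hwm₁, hwm₂, hwm₃, hsolm⟩ := hc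
  obtain ⟨σ₁, -, -, hfam, ρ, hρ, huniq⟩ :=
    LsFamily.stub_lsFamily S c ν u₀ p₀ v h hν hst h0 hv₁ hv₂ hv₃ hker hh₁ hh₂ hh₃ hvis
  obtain ⟨σ₂, hex₂, hsign₂⟩ :=
    LsIndefiniteNS.stub_lsIndefinite S c d ν u₀ p₀ v h wd wp wm tp tm α β hν hst h0 hv₁ hv₂ hv₃ hker hh₁ hh₂ hh₃ hvis
      hwd₁ hwd₂ hwd₃ hresp hphase hα hβ hwp₁ hwp₂ hwp₃ hsolp hwm₁ hwm₂ hwm₃ hsolm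
  -- `σ₂ = σ₁` on a ball around `(c, 0)`
  obtain ⟨r₂, hr₂, hball₂⟩ := hex₂ ρ hρ
  have heq : ∀ q ∈ Metric.ball ((c, 0) : Coeff S × ℝ) (min r₂ ρ), σ₂ q = σ₁ q := by
    intro q hq
    have hq₂ : q ∈ Metric.ball ((c, 0) : Coeff S × ℝ) r₂ := Metric.ball_subset_ball (min_le_left _ _) hq
    have hqρ : dist q (c, 0) < ρ := lt_of_lt_of_le (Metric.mem_ball.1 hq) (min_le_right _ _)
    rw [Prod.dist_eq, Real.dist_eq, sub_zero] at hqρ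
    obtain ⟨hσ, u', p', hst', hm', hlat, hph⟩ := hball₂ q hq₂
    exact huniq q.1 q.2 (σ₂ q) u' p' (lt_of_le_of_lt (le_max_left _ _) hqρ)
      (lt_of_le_of_lt (le_max_right _ _) hqρ) hσ hst' hm' hlat hph
  refine ⟨ν, hν, hνa, u₀, p₀, hst, h0, hE, hε, σ₁, fun δ hδ => ?_, fun η hη => ?_⟩
  · -- zeros of `σ₁` are steady states of the uncorrected force
    obtain ⟨r, hr, hcont, hball⟩ := hfam δ hδ
    refine ⟨r, hr, hcont, fun q hq hσq => ?_⟩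
    obtain ⟨-, u', p', hst', hm', hd, -, -⟩ := hball q hq
    refine ⟨u', p', ?_, hm', hd⟩
    have e : (fun y => force S q.1 y - σ₁ q • h y) = force S q.1 := by
      funext y; rw [hσq, zero_smul, sub_zero]
    rwa [e] at hst'
  · -- the robust sign change of `σ₂`, transported to `σ₁`
    obtain ⟨s, x₁, x₂, hs, hx₁, hx₂, hσ₁, hσ₂⟩ := hsign₂ (min η (min r₂ ρ)) (lt_min hη (lt_min hr₂ hρ))
    have hmem : ∀ x : ℝ, |x| < min η (min r₂ ρ) → ((c + s • d, x) : Coeff S × ℝ) ∈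
        Metric.ball ((c, 0) : Coeff S × ℝ) (min r₂ ρ) := fun x hx => by
      rw [Metric.mem_ball, Prod.dist_eq, Real.dist_eq, sub_zero]
      exact max_lt (lt_of_lt_of_le hs (min_le_right _ _)) (lt_of_lt_of_le hx (min_le_right _ _))
    refine ⟨c + s • d, x₁, x₂, lt_of_lt_of_le hs (min_le_left _ _), lt_of_lt_of_le hx₁ (min_le_left _ _),
      lt_of_lt_of_le hx₂ (min_le_left _ _), ?_, ?_⟩
    · rw [← heq _ (hmem x₁ hx₁)]; exact hσ₁
    · rw [← heq _ (hmem x₂ hx₂)]; exact hσ₂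

/-- **`indefiniteSteady ⊆ closure (interior LOUD)`**: invisible saddles are limits of robustly loud forces. [folklore] -/
theorem indefiniteSteady_subset_closure_interior_loud (S : Finset (Fin 3 → ℤ)) (a E ε : ℝ) :
    indefiniteSteady S a E ε ⊆ closure (interior (loud S a E ε)) :=
  (indefiniteSteady_subset_robustCrossingSteady S a E ε).trans (robustCrossingSteady_subset_closure_interior_loud S a E ε)

/-- **The extended tame union is force-open up to closure.** [folklore] -/
theorem tameCrossing2_subset_closure_interior_loud (S : Finset (Fin 3 → ℤ)) (a E ε : ℝ) :
    tameCrossing2 S a E ε ⊆ closure (interior (loud S a E ε)) :=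
  Set.union_subset (tameCrossing_subset_closure_interior_loud S a E ε) (indefiniteSteady_subset_closure_interior_loud S a E ε)

/-- **Extended line glue of the companion c2 (registered sub-goal `line_glue_c2b`)**: the residual over `tameCrossing2` proves the crux.
[folklore] -/
theorem line_glue_c2b : (∀ S : Finset (Fin 3 → ℤ), unitStock ⊆ S → ∀ (a E ε : ℝ), 0 < a → 0 < ε → loud S a E ε ⊆ closure (tameCrossing2 S a (2 * E) (ε / 2))) → RobustLoudUpgrade :=
  fun hRes => RobustLoudUpgrade_of_residual (fun S a E ε => tameCrossing2 S a E ε)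
    tameCrossing2_subset_closure_interior_loud hRes

end LsCrossing

end Summit.AnomalousDissipation.AnomalousDissipation.Theorems.RobustLoudUpgrade

end
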